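import Mathlib
import HarnessLib

/-!
# The Wigner semicircle law on `[-1, 1]`: Stein identity, moments, and moment determinacy on a compact interval

HONEST FRAMING: exact (Metropolis-corrected) sampling algorithms for lattice gauge theory;
figures of merit are autocorrelation/cost numbers at stated couplings and volumes; no
continuum-physics claim.

Venture `LatticeQCDFlow` (cell pub-lqcd), topic `Exactness`, FANOUT row 9 (eng-latcore).  The
real-analysis half of the identification of the `a₀ = Re tr U / 2` marginal of Haar measure on SU(2)
(the reference law `(2/π)√(1 − a₀²) da₀` of acceptance test A3 at `βk = 0`; `SU2A0Marginal.lean`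
assembles).  NEW WORK of the cell; nothing is cited as a fact.  No group theory here.

* `semicircleDensity t = (2/π) √(1 − t²)` (zero off `[-1, 1]`), `semicircleLaw = volume.withDensity`;
* **`semicircle_stein`** — `∫_{-1}^{1} [(1 − t²) ψ′(t) − 3 t ψ(t)] (2/π)√(1 − t²) dt = 0` for every `C¹`
  `ψ` (integration by parts: the bracket times the density is the derivative of
  `(1 − t²) ψ(t) · (2/π)√(1 − t²)`, which vanishes at `±1`);
* `semicircleMoment k = ∫_{-1}^{1} t^k (2/π)√(1 − t²) dt`, `semicircleMoment_zero = 1`,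
  **`semicircleMoment_rec`** `(k + 3) S_{k+1} = k S_{k−1}` — the same recursion as the Haar moments
  of `a₀` (`SU2A0Moments.lean`);
* **`measure_eq_of_forall_integral_pow_eq`** — Hausdorff moment determinacy on a compact interval:
  two finite Borel measures on `ℝ` carried by `[a, b]` with equal moments are equal (Weierstrass
  approximation + bounded-continuous-function extensionality).
-/

namespace Summit.Ventures.LatticeQCDFlow.Exactness

open MeasureTheory Set Polynomial
open scoped Topology BoundedContinuousFunction

/-! ## §1 The density -/

/-- The Wigner semicircle density of radius `1`: `(2/π) √(1 − t²)`; it vanishes for `|t| ≥ 1`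
because `√x = 0` for `x ≤ 0`. -/
noncomputable def semicircleDensity (t : ℝ) : ℝ := 2 / Real.pi * Real.sqrt (1 - t ^ 2)

/-- The density is nonnegative. -/
theorem semicircleDensity_nonneg (t : ℝ) : 0 ≤ semicircleDensity t := by
  unfold semicircleDensity; positivity

/-- The density vanishes off `[-1, 1]`. -/
theorem semicircleDensity_eq_zero {t : ℝ} (ht : t ∉ Icc (-1 : ℝ) 1) : semicircleDensity t = 0 := by
  rw [mem_Icc, not_and_or, not_le, not_le] at ht
  have h : 1 - t ^ 2 ≤ 0 := by rcases ht with h | h <;> nlinarith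
  rw [semicircleDensity, Real.sqrt_eq_zero'.mpr h, mul_zero]

/-- The density is continuous. -/
theorem continuous_semicircleDensity : Continuous semicircleDensity :=
  continuous_const.mul ((continuous_const.sub (continuous_pow 2)).sqrt)

/-- **The semicircle law** as a measure on `ℝ`. -/
noncomputable def semicircleLaw : Measure ℝ :=
  volume.withDensity fun t => ENNReal.ofReal (semicircleDensity t)

/-- The `k`-th moment `∫_{-1}^{1} t^k (2/π)√(1 − t²) dt`. -/
noncomputable def semicircleMoment (k : ℕ) : ℝ :=
  ∫ t in (-1 : ℝ)..1, t ^ k * semicircleDensity t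

/-- Normalisation: `∫_{-1}^{1} (2/π)√(1 − t²) dt = 1`. -/
theorem semicircleMoment_zero : semicircleMoment 0 = 1 := by
  simp only [semicircleMoment, pow_zero, one_mul, semicircleDensity]
  rw [intervalIntegral.integral_const_mul, integral_sqrt_one_sub_sq]
  field_simp

/-! ## §2 The Stein (integration-by-parts) identity and the moment recursion -/

/-- **Stein identity of the semicircle law**: for every `C¹` function `ψ` with continuous derivative,
`∫_{-1}^{1} [(1 − t²) ψ′(t) − 3 t ψ(t)] (2/π)√(1 − t²) dt = 0`. -/
theorem semicircle_stein {ψ ψ' : ℝ → ℝ} (hψ : ∀ x, HasDerivAt ψ (ψ' x) x) (hψ'c : Continuous ψ') :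
    ∫ t in (-1 : ℝ)..1, ((1 - t ^ 2) * ψ' t - 3 * t * ψ t) * semicircleDensity t = 0 := by
  have hψc : Continuous ψ := continuous_iff_continuousAt.mpr fun x => (hψ x).continuousAt
  have hFc : Continuous fun t : ℝ => (1 - t ^ 2) * ψ t * semicircleDensity t :=
    (((continuous_const.sub (continuous_pow 2)).mul hψc).mul continuous_semicircleDensity)
  have hderiv : ∀ t ∈ Ioo (-1 : ℝ) 1, HasDerivAt (fun t : ℝ => (1 - t ^ 2) * ψ t * semicircleDensity t)
      (((1 - t ^ 2) * ψ' t - 3 * t * ψ t) * semicircleDensity t) t := by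
    intro t ht
    rw [mem_Ioo] at ht
    have hpos : 0 < 1 - t ^ 2 := by nlinarith
    have h1 : HasDerivAt (fun x : ℝ => 1 - x ^ 2) (-(2 * t)) t := by
      simpa using (hasDerivAt_pow 2 t).const_sub 1
    have h2 : HasDerivAt (fun x : ℝ => Real.sqrt (1 - x ^ 2))
        (1 / (2 * Real.sqrt (1 - t ^ 2)) * (-(2 * t))) t :=
      (Real.hasDerivAt_sqrt hpos.ne').comp t h1
    have h3 : HasDerivAt semicircleDensity
        (2 / Real.pi * (1 / (2 * Real.sqrt (1 - t ^ 2)) * (-(2 * t)))) t := by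
      show HasDerivAt (fun x => 2 / Real.pi * Real.sqrt (1 - x ^ 2)) _ t
      exact h2.const_mul _
    refine ((h1.mul (hψ t)).mul h3).congr_deriv ?_
    simp only [semicircleDensity, Pi.mul_apply]
    set s := Real.sqrt (1 - t ^ 2) with hs
    have hs0 : s ≠ 0 := (Real.sqrt_pos.mpr hpos).ne'
    have hss : s * s = 1 - t ^ 2 := Real.mul_self_sqrt hpos.le
    rw [← hss]
    field_simp
    ring
  have hint : IntervalIntegrable (fun t : ℝ => ((1 - t ^ 2) * ψ' t - 3 * t * ψ t) * semicircleDensity t)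
      volume (-1) 1 :=
    (((((continuous_const.sub (continuous_pow 2)).mul hψ'c).sub
      ((continuous_const.mul continuous_id).mul hψc)).mul
        continuous_semicircleDensity).intervalIntegrable _ _)
  rw [intervalIntegral.integral_eq_sub_of_hasDerivAt_of_le (by norm_num) hFc.continuousOn hderiv hint]
  norm_num

/-- **Moment recursion of the semicircle law** (`ψ = t^k`): `(k + 3) S_{k+1} = k S_{k−1}`. -/
theorem semicircleMoment_rec (k : ℕ) :
    ((k : ℝ) + 3) * semicircleMoment (k + 1) = k * semicircleMoment (k - 1) := by
  have h := semicircle_stein (ψ := fun x => x ^ k) (ψ' := fun x => (k : ℝ) * x ^ (k - 1))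
    (fun x => hasDerivAt_pow k x) (continuous_const.mul (continuous_pow _))
  have hk : ∀ a : ℝ, (k : ℝ) * (a ^ 2 * a ^ (k - 1)) = k * a ^ (k + 1) := by
    intro a
    cases k with
    | zero => simp
    | succ j => simp only [Nat.add_sub_cancel, pow_succ, Nat.cast_succ]; ring
  have hpt : ∀ t : ℝ, ((1 - t ^ 2) * ((k : ℝ) * t ^ (k - 1)) - 3 * t * t ^ k) * semicircleDensity t
      = (k : ℝ) * (t ^ (k - 1) * semicircleDensity t)
        - ((k : ℝ) + 3) * (t ^ (k + 1) * semicircleDensity t) := by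
    intro t
    have h1 := hk t
    calc _ = ((k : ℝ) * t ^ (k - 1) - (k : ℝ) * (t ^ 2 * t ^ (k - 1)) - 3 * t ^ (k + 1))
          * semicircleDensity t := by ring
      _ = ((k : ℝ) * t ^ (k - 1) - (k : ℝ) * t ^ (k + 1) - 3 * t ^ (k + 1))
          * semicircleDensity t := by rw [h1]
      _ = _ := by ring
  simp_rw [hpt] at h
  have hi : ∀ (r : ℝ) (j : ℕ), IntervalIntegrable (fun t : ℝ => r * (t ^ j * semicircleDensity t))
      volume (-1) 1 := fun r j =>
    (continuous_const.mul ((continuous_pow j).mul continuous_semicircleDensity)).intervalIntegrable _ _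
  rw [intervalIntegral.integral_sub (hi _ _) (hi _ _), intervalIntegral.integral_const_mul,
    intervalIntegral.integral_const_mul] at h
  simp only [semicircleMoment]
  linarith

/-- `S₁ = 0`. -/
theorem semicircleMoment_one : semicircleMoment 1 = 0 := by
  have h := semicircleMoment_rec 0
  norm_num at h
  exact h

/-! ## §3 Moment determinacy on a compact interval -/

/-- **Hausdorff moment determinacy on `[a, b]`.**  Two finite Borel measures on `ℝ` carried by
`[a, b]` with the same moments `∫ x^k` are equal.  (Weierstrass: polynomials are uniformly dense in
`C([a, b])`; finite Borel measures on a metric space are determined by the integrals of bounded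
continuous functions.) -/
theorem measure_eq_of_forall_integral_pow_eq {μ ν : Measure ℝ} [IsFiniteMeasure μ]
    [IsFiniteMeasure ν] {a b : ℝ} (hμ : μ (Icc a b)ᶜ = 0) (hν : ν (Icc a b)ᶜ = 0)
    (h : ∀ k : ℕ, ∫ x, x ^ k ∂μ = ∫ x, x ^ k ∂ν) : μ = ν := by
  have aeμ : ∀ᵐ x ∂μ, x ∈ Icc a b := ae_iff.mpr hμ
  have aeν : ∀ᵐ x ∂ν, x ∈ Icc a b := ae_iff.mpr hν
  -- continuous functions are integrable (bounded on the carrier)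
  have hint : ∀ {ρ : Measure ℝ} [IsFiniteMeasure ρ], (∀ᵐ x ∂ρ, x ∈ Icc a b) →
      ∀ {g : ℝ → ℝ}, Continuous g → Integrable g ρ := by
    intro ρ _ hρ g hg
    obtain ⟨C, hC⟩ := isCompact_Icc.exists_bound_of_continuousOn (hg.continuousOn (s := Icc a b))
    exact Integrable.mono' (integrable_const C) hg.aestronglyMeasurable
      (hρ.mono fun x hx => hC x hx)
  -- polynomials
  have hpoly : ∀ p : ℝ[X], ∫ x, p.eval x ∂μ = ∫ x, p.eval x ∂ν := by
    intro p
    refine p.induction_on' (fun p q hp hq => ?_) (fun n c => ?_)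
    · simp only [eval_add]
      rw [integral_add (hint aeμ p.continuous) (hint aeμ q.continuous),
        integral_add (hint aeν p.continuous) (hint aeν q.continuous), hp, hq]
    · simp only [eval_monomial]
      rw [integral_const_mul, integral_const_mul, h n]
  -- bounded continuous functions, by uniform approximation on `[a, b]`
  refine ext_of_forall_integral_eq_of_IsFiniteMeasure fun f => ?_
  refine eq_of_forall_dist_le fun ε hε => ?_
  set m : ℝ := μ.real univ + ν.real univ + 1 with hm
  have hm0 : 0 < m := by positivity
  obtain ⟨p, hp⟩ := exists_polynomial_near_of_continuousOn a b f f.continuous.continuousOn (ε / m)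
    (div_pos hε hm0)
  have e1 : ‖∫ x, f x ∂μ - ∫ x, p.eval x ∂μ‖ ≤ ε / m * μ.real univ := by
    rw [← integral_sub (f.integrable μ) (hint aeμ p.continuous)]
    exact norm_integral_le_of_norm_le_const (aeμ.mono fun x hx => by
      rw [Real.norm_eq_abs, abs_sub_comm]; exact (hp x hx).le)
  have e2 : ‖∫ x, f x ∂ν - ∫ x, p.eval x ∂ν‖ ≤ ε / m * ν.real univ := by
    rw [← integral_sub (f.integrable ν) (hint aeν p.continuous)]
    exact norm_integral_le_of_norm_le_const (aeν.mono fun x hx => by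
      rw [Real.norm_eq_abs, abs_sub_comm]; exact (hp x hx).le)
  have hμ0 : 0 ≤ μ.real univ := measureReal_nonneg
  have hν0 : 0 ≤ ν.real univ := measureReal_nonneg
  rw [dist_eq_norm]
  calc ‖∫ x, f x ∂μ - ∫ x, f x ∂ν‖
      = ‖(∫ x, f x ∂μ - ∫ x, p.eval x ∂μ) - (∫ x, f x ∂ν - ∫ x, p.eval x ∂ν)‖ := by
        rw [hpoly p]; congr 1; ring
    _ ≤ ‖∫ x, f x ∂μ - ∫ x, p.eval x ∂μ‖ + ‖∫ x, f x ∂ν - ∫ x, p.eval x ∂ν‖ := norm_sub_le _ _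
    _ ≤ ε / m * μ.real univ + ε / m * ν.real univ := add_le_add e1 e2
    _ = ε * ((μ.real univ + ν.real univ) / m) := by ring
    _ ≤ ε * 1 := by
        refine mul_le_mul_of_nonneg_left ?_ hε.le
        rw [div_le_one hm0, hm]
        linarith
    _ = ε := mul_one ε

/-! ## §4 The semicircle law: carrier, mass, moments -/

/-- The semicircle law is carried by `[-1, 1]`. -/
theorem semicircleLaw_compl_Icc : semicircleLaw (Icc (-1 : ℝ) 1)ᶜ = 0 := by
  rw [semicircleLaw, withDensity_apply _ measurableSet_Icc.compl]
  refine (setLIntegral_congr_fun measurableSet_Icc.compl (fun t ht => ?_)).trans lintegral_zero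
  · rw [semicircleDensity_eq_zero ht, ENNReal.ofReal_zero]

/-- Integration against the semicircle law is integration against the density over `[-1, 1]`
(for every `g : ℝ → ℝ`). -/
theorem integral_semicircleLaw (g : ℝ → ℝ) :
    ∫ t, g t ∂semicircleLaw = ∫ t in (-1 : ℝ)..1, g t * semicircleDensity t := by
  have h1 : ∫ t, g t ∂semicircleLaw = ∫ t, semicircleDensity t * g t := by
    rw [semicircleLaw]
    have := integral_withDensity_eq_integral_smul (μ := volume)
      (f := fun t => (semicircleDensity t).toNNReal)
      (continuous_semicircleDensity.measurable.real_toNNReal) g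
    refine this.trans (integral_congr_ae (Filter.Eventually.of_forall fun t => ?_))
    simp only [NNReal.smul_def, smul_eq_mul, Real.coe_toNNReal _ (semicircleDensity_nonneg t)]
  rw [h1, intervalIntegral.integral_of_le (by norm_num : (-1 : ℝ) ≤ 1), ← integral_Icc_eq_integral_Ioc,
    setIntegral_eq_integral_of_forall_compl_eq_zero fun t ht => ?_]
  · exact integral_congr_ae (Filter.Eventually.of_forall fun t => mul_comm _ _)
  · rw [semicircleDensity_eq_zero ht, mul_zero]

/-- The semicircle law is a probability measure. -/
instance isProbabilityMeasure_semicircleLaw : IsProbabilityMeasure semicircleLaw := by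
  constructor
  have hi : Integrable semicircleDensity volume := by
    refine (integrableOn_iff_integrable_of_support_subset (s := Icc (-1 : ℝ) 1) fun t ht => ?_).mp
      (continuous_semicircleDensity.continuousOn.integrableOn_compact isCompact_Icc)
    by_contra h
    exact ht (semicircleDensity_eq_zero h)
  rw [semicircleLaw, withDensity_apply _ MeasurableSet.univ, Measure.restrict_univ,
    ← ofReal_integral_eq_lintegral_ofReal hi (Filter.Eventually.of_forall semicircleDensity_nonneg),
    ← setIntegral_eq_integral_of_forall_compl_eq_zero (s := Icc (-1 : ℝ) 1)
      (fun t ht => semicircleDensity_eq_zero ht),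
    integral_Icc_eq_integral_Ioc, ← intervalIntegral.integral_of_le (by norm_num : (-1 : ℝ) ≤ 1)]
  have := semicircleMoment_zero
  simp only [semicircleMoment, pow_zero, one_mul] at this
  rw [this, ENNReal.ofReal_one]

/-- The moments of the semicircle law. -/
theorem integral_pow_semicircleLaw (k : ℕ) : ∫ t, t ^ k ∂semicircleLaw = semicircleMoment k :=
  integral_semicircleLaw _

end Summit.Ventures.LatticeQCDFlow.Exactness
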